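import Literature.AlgebraicGeometry.Motives.HodgeThetaSubalgebraUnitaryLeviKernel
import HarnessLib

/-!
# Pencils of raising operators through a full Levi algebra on the smaller side: rank constraints
# (Ribet 1983 Thm. 3, Lie step — the «double Levi» route, part III)

Family `hodge`, layer `Literature/AlgebraicGeometry/Motives` (pure linear algebra over `ℂ`; no geometry). Research
context: cell `pub-hodge-ring2` (HONEST FRAMING: research route conditional on HC_CM; not a corollary; Q11.4-sentence-2
already refuted in dim ≥ 3), Literature lane gen 85, programme R70. UNCONDITIONAL; theorems only, no definition, no
named fact (D-0026), no `sorry`. Sequel of `HodgeThetaSubalgebraUnitaryLeviKernel`.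

PURPOSE. Parts I–II show that in the unitary setting with `a = dim P < b = dim Q` any raising operator whose rank `ρ` has
a known core of type `(ρ | b − ρ)` forces `𝔊 = End(W)`. What is left at `(a, b) = (8, 9)` is to exclude the world in
which EVERY raising operator has rank in `{0, 3, 6}`. This file supplies the tool for the rank-`3` half: if a raising `A`
of rank `ρ` has a full Levi algebra on the SMALLER side `U⁺ = (P ∩ ker C_A) ⊕ C_A(P)` (type `(a − ρ | ρ)`; at `(8,9)`,
`ρ = 3`, this is the `(5 | 3)` core), then rank-one endomorphisms `e_i ⊗ ψ_i` of `U⁺` (`i = 1, 2`, independent `e_i`,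
independent `ψ_i`) lift to raising operators `B_i ∈ 𝔊` commuting with `ι_A`, `B_i = (e_i ⊗ ψ_i) ⊕ B_i|_{U⁻}`, and the
pencil `B₁ + c B₂` has rank `rk(e₁ ⊗ ψ₁ + c·e₂ ⊗ ψ₂) + rk((B₁ + cB₂)|_{U⁻})`, the first summand being `1` for `c = 0`
and `2` for `c ≠ 0`, the second at most `ρ`. The THREE-POINT LEMMA (§1 `UnitaryPencil.exists_line_of_three`: if
`M + N`, `M − N`, `M + 2N` all have rank `≤ 1` then so does `M`) then says: the `U⁻`-ranks `m₁, m₂, m₃` at `c = 1, −1, 2`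
cannot all be `≤ 1` unless the `U⁻`-rank `m₀` at `c = 0` is `≤ 1` (§2 **`UnitaryPencil.exists_pencil_of_core`**). At
`(8, 9)` with all ranks in `{0,3,6}`: `1 + m₀ ∈ {3, 6}` forces `m₀ = 2`, `2 + m_c ∈ {3, 6}` forces `m_c = 1` —
contradiction (sequel file).

## References
* [Ribet1983] K. A. Ribet, *Hodge classes on certain types of abelian varieties*, Amer. J. Math. 105 (1983), Thm. 3
  (= [Gordon1997, Thm. 6.3 (3)], pp. 18–19).
* [Deligne1982HodgeCycles] P. Deligne, *Hodge cycles on abelian varieties*, LNM 900 (1982), I §3 Prop. 3.4, 3.6.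
* [GoodmanWallachGTM255] R. Goodman, N. R. Wallach, GTM 255 (2009), §4.1.1.
* [HoffmanKunze1971LinearAlgebra] K. Hoffman, R. Kunze, *Linear Algebra* (1971), §3.1–3.2 (rank), §3.6 (dual pairs).
-/

noncomputable section

open Module

namespace Literature.AlgebraicGeometry.Motives

namespace HodgeStructure

universe u

variable {W : Type u} [AddCommGroup W] [Module ℂ W]

/-! ### §1 Rank-`≤ 1` operators: the three-point lemma, dual pairs, lines -/

/-- **Three-point lemma.** If `f + g`, `f − g` and `f + 2g` all take values on lines, then so does `f`. (With
`R₁ = f + g`, `R₂ = f − g`: `3R₁ − R₂ = 2(f + 2g)`; if the lines of `R₁`, `R₂` differ, comparing coefficients along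
them shows the coordinate functionals of `R₁`, `R₂` proportional, so `2f = R₁ + R₂` has values on a line.)
[cite: HoffmanKunze1971LinearAlgebra, §3.1] -/
theorem UnitaryPencil.exists_line_of_three {E F : Type*} [AddCommGroup E] [Module ℂ E] [AddCommGroup F] [Module ℂ F]
    (f g : E →ₗ[ℂ] F) {p₁ p₂ p₃ : F} (h₁ : ∀ x, (f + g) x ∈ ℂ ∙ p₁) (h₂ : ∀ x, (f - g) x ∈ ℂ ∙ p₂)
    (h₃ : ∀ x, (f + (2 : ℂ) • g) x ∈ ℂ ∙ p₃) : ∃ p : F, ∀ x, f x ∈ ℂ ∙ p := by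
  classical
  -- it suffices to put the values of `R₁ + R₂ = 2f` on a line
  suffices h : ∃ p : F, ∀ x, (f + g) x + (f - g) x ∈ ℂ ∙ p by
    obtain ⟨p, hp⟩ := h
    refine ⟨p, fun x => ?_⟩
    have h2 : f x = (2 : ℂ)⁻¹ • ((f + g) x + (f - g) x) := by
      simp only [LinearMap.add_apply, LinearMap.sub_apply]; module
    rw [h2]; exact Submodule.smul_mem _ _ (hp x)
  by_cases hp₂ : p₂ ∈ ℂ ∙ p₁
  · refine ⟨p₁, fun x => Submodule.add_mem _ (h₁ x) ?_⟩
    exact (Submodule.span_singleton_le_iff_mem _ _).2 hp₂ (h₂ x)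
  by_cases hp₁ : p₁ = 0
  · refine ⟨p₂, fun x => Submodule.add_mem _ ?_ (h₂ x)⟩
    have := h₁ x
    rw [hp₁, Submodule.span_zero_singleton, Submodule.mem_bot] at this
    rw [this]; exact Submodule.zero_mem _
  -- coordinates along `p₁`, `p₂`
  choose a ha using fun x => Submodule.mem_span_singleton.1 (h₁ x)
  choose b hb using fun x => Submodule.mem_span_singleton.1 (h₂ x)
  by_cases hR₂ : ∀ x, (f - g) x = 0
  · refine ⟨p₁, fun x => ?_⟩
    rw [hR₂ x, add_zero]; exact h₁ x
  push Not at hR₂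
  obtain ⟨x₀, hx₀⟩ := hR₂
  have hb₀ : b x₀ ≠ 0 := fun h => hx₀ (by rw [← hb x₀, h, zero_smul])
  -- `v x = 3 a(x) p₁ − b(x) p₂ = 2 (f + 2g) x` lies on the line `ℂ p₃`
  have hv : ∀ x, (3 * a x) • p₁ + (-b x) • p₂ = (2 : ℂ) • (f + (2 : ℂ) • g) x := fun x => by
    have e1 := ha x; have e2 := hb x
    simp only [LinearMap.add_apply, LinearMap.sub_apply, LinearMap.smul_apply] at e1 e2 ⊢
    rw [mul_smul, e1, neg_smul, e2]
    module
  have hv₀ : (3 * a x₀) • p₁ + (-b x₀) • p₂ ≠ 0 := fun h => by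
    obtain ⟨-, h2⟩ := UnitaryAdStable.eq_zero_of_pair hp₁ hp₂ h
    exact hb₀ (neg_eq_zero.1 h2)
  obtain ⟨c₀, hc₀⟩ := Submodule.mem_span_singleton.1 (h₃ x₀)
  have hc₀0 : c₀ ≠ 0 := fun h => hv₀ (by
    rw [hv, ← hc₀, h, zero_smul, smul_zero])
  have hprop : ∀ x, a x * b x₀ = a x₀ * b x := fun x => by
    obtain ⟨c, hc⟩ := Submodule.mem_span_singleton.1 (h₃ x)
    -- `v x = (c / c₀) • v x₀`
    have hvx : (3 * a x) • p₁ + (-b x) • p₂ = (c * c₀⁻¹) • ((3 * a x₀) • p₁ + (-b x₀) • p₂) := by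
      rw [hv, hv, ← hc, ← hc₀, smul_comm (2 : ℂ) c₀, smul_smul (c * c₀⁻¹), mul_assoc, inv_mul_cancel₀ hc₀0, mul_one,
        smul_comm]
    rw [smul_add, smul_smul, smul_smul] at hvx
    obtain ⟨e1, e2⟩ := UnitaryAdStable.coeff_eq_of_pair hp₁ hp₂ hvx
    have e1' : a x = c * c₀⁻¹ * a x₀ := by
      have := e1; field_simp at this ⊢; linear_combination this
    have e2' : b x = c * c₀⁻¹ * b x₀ := by
      have := e2; rw [mul_neg, neg_inj] at this; exact this
    rw [e1', e2']; ring
  refine ⟨(a x₀ * (b x₀)⁻¹) • p₁ + p₂, fun x => ?_⟩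
  rw [← ha x, ← hb x]
  have hax : a x = b x * (a x₀ * (b x₀)⁻¹) := by
    field_simp
    linear_combination hprop x
  rw [hax, Submodule.mem_span_singleton]
  exact ⟨b x, by rw [smul_add, smul_smul]⟩

/-- A dual pair for two independent vectors: `χ₁(u) = 1, χ₁(v) = 0, χ₂(u) = 0, χ₂(v) = 1`.
[cite: HoffmanKunze1971LinearAlgebra, §3.6] -/
theorem UnitaryPencil.exists_dual_pair {u v : W} (hu : u ≠ 0) (hv : v ∉ ℂ ∙ u) :
    ∃ χ₁ χ₂ : Module.Dual ℂ W, χ₁ u = 1 ∧ χ₁ v = 0 ∧ χ₂ u = 0 ∧ χ₂ v = 1 := by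
  have hv0 : v ≠ 0 := fun h => hv (by rw [h]; exact Submodule.zero_mem _)
  have hu' : u ∉ ℂ ∙ v := fun h => by
    obtain ⟨c, hc⟩ := Submodule.mem_span_singleton.1 h
    have hc0 : c ≠ 0 := fun h0 => hu (by rw [← hc, h0, zero_smul])
    exact hv (Submodule.mem_span_singleton.2 ⟨c⁻¹, by rw [← hc, smul_smul, inv_mul_cancel₀ hc0, one_smul]⟩)
  -- `χ₁`
  obtain ⟨φv, hφv⟩ := Module.Projective.exists_dual_eq_one ℂ hv0
  have hu1 : u - φv u • v ≠ 0 := fun h => hu' (Submodule.mem_span_singleton.2 ⟨φv u, (sub_eq_zero.1 h).symm⟩)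
  obtain ⟨χ₀, hχ₀⟩ := Module.Projective.exists_dual_eq_one ℂ hu1
  -- `χ₂`
  obtain ⟨φu, hφu⟩ := Module.Projective.exists_dual_eq_one ℂ hu
  have hv1 : v - φu v • u ≠ 0 := fun h => hv (Submodule.mem_span_singleton.2 ⟨φu v, (sub_eq_zero.1 h).symm⟩)
  obtain ⟨χ₀', hχ₀'⟩ := Module.Projective.exists_dual_eq_one ℂ hv1
  refine ⟨χ₀ ∘ₗ (1 - φv.smulRight v), χ₀' ∘ₗ (1 - φu.smulRight u), ?_, ?_, ?_, ?_⟩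
  · rw [LinearMap.comp_apply, LinearMap.sub_apply, Module.End.one_apply, LinearMap.smulRight_apply, hχ₀]
  · rw [LinearMap.comp_apply, LinearMap.sub_apply, Module.End.one_apply, LinearMap.smulRight_apply, hφv, one_smul,
      sub_self, map_zero]
  · rw [LinearMap.comp_apply, LinearMap.sub_apply, Module.End.one_apply, LinearMap.smulRight_apply, hφu, one_smul,
      sub_self, map_zero]
  · rw [LinearMap.comp_apply, LinearMap.sub_apply, Module.End.one_apply, LinearMap.smulRight_apply, hχ₀']

/-- In a subspace of dimension `≥ 2` there are two independent vectors. [cite: HoffmanKunze1971LinearAlgebra, §2.3] -/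
theorem UnitaryPencil.exists_pair_of_two_le_finrank [FiniteDimensional ℂ W] (S : Submodule ℂ W)
    (h2 : 2 ≤ Module.finrank ℂ S) : ∃ u ∈ S, ∃ v ∈ S, u ≠ 0 ∧ v ∉ ℂ ∙ u := by
  obtain ⟨⟨u, hu⟩, hu0⟩ := Module.finrank_pos_iff_exists_ne_zero.1 (show 0 < Module.finrank ℂ S by omega)
  have hu0' : u ≠ 0 := fun h => hu0 (Subtype.ext h)
  by_contra hne
  push Not at hne
  have hle : S ≤ ℂ ∙ u := fun v hv => hne u hu v hv hu0'
  have h1 : Module.finrank ℂ (ℂ ∙ u) = 1 := finrank_span_singleton hu0'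
  have := Submodule.finrank_mono hle
  omega

/-- If the image of `U` under `X` has dimension `≤ 1`, the values of `X` on `U` lie on a line.
[cite: HoffmanKunze1971LinearAlgebra, §3.1] -/
theorem UnitaryPencil.exists_line_of_finrank_map_le_one [FiniteDimensional ℂ W] (X : Module.End ℂ W)
    (U : Submodule ℂ W) (h : Module.finrank ℂ ↥(U.map X) ≤ 1) : ∃ p : W, ∀ x ∈ U, X x ∈ ℂ ∙ p := by
  by_cases h0 : U.map X = ⊥
  · refine ⟨0, fun x hx => ?_⟩
    have : X x ∈ U.map X := Submodule.mem_map_of_mem hx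
    rw [h0, Submodule.mem_bot] at this
    rw [this]; exact Submodule.zero_mem _
  · obtain ⟨y, hy, hy0⟩ := Submodule.exists_mem_ne_zero_of_ne_bot h0
    exact ⟨y, fun x hx => UnitaryTwoOdd.mem_span_of_finrank_le_one h hy (Submodule.mem_map_of_mem hx) hy0⟩

/-! ### §2 The pencil of raising operators through a full Levi algebra on `U⁺` -/

/-- **Pencil lemma.** Setting of the unitary cores; `A ∈ 𝔊` raising of rank `ρ ≥ 2` with `dim P ≥ ρ + 2`, and the
abstract core of type `(dim P − ρ | ρ)` (hypothesis-schema `hcore`, literally that of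
`UnitaryRaisingRank.exists_raise_rank_gt_of_psi_core`). Then there are raising `B₁, B₂ ∈ 𝔊` and integers
`m₀, m₁, m₂, m₃ ≤ ρ` with `rk B₁ = 1 + m₀`, `rk(B₁ + B₂) = 2 + m₁`, `rk(B₁ − B₂) = 2 + m₂`, `rk(B₁ + 2B₂) = 2 + m₃`, and
`m₁, m₂, m₃ ≤ 1 ⟹ m₀ ≤ 1`. See the module docstring. [cite: Ribet1983, Thm. 3] [cite: Deligne1982HodgeCycles, I §3 Prop. 3.6]
[cite: GoodmanWallachGTM255, §4.1.1] [cite: HoffmanKunze1971LinearAlgebra, §3.1] -/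
theorem UnitaryPencil.exists_pencil_of_core [FiniteDimensional ℂ W] {𝔊 : Submodule ℂ (Module.End ℂ W)}
    (hbr : ∀ Y ∈ 𝔊, ∀ Z ∈ 𝔊, Y * Z - Z * Y ∈ 𝔊)
    (hirr : ∀ U : Submodule ℂ W, (∀ A ∈ 𝔊, ∀ u ∈ U, A u ∈ U) → U = ⊥ ∨ U = ⊤)
    {Θ : Module.End ℂ W} (hΘ : Θ ∈ 𝔊) (hΘΘ : Θ * Θ = 1)
    {P Q : Submodule ℂ W} (hP : ∀ x, x ∈ P ↔ Θ x = x) (hQ : ∀ x, x ∈ Q ↔ Θ x = -x)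
    {s : W → W → ℂ} (hadd : ∀ x y z, s (x + y) z = s x z + s y z) (hsymm : ∀ x y, s y x = starRingEnd ℂ (s x y))
    (hPQ : ∀ p ∈ P, ∀ q ∈ Q, s p q = 0) (hdefP : ∀ p ∈ P, s p p = 0 → p = 0) (hdefQ : ∀ q ∈ Q, s q q = 0 → q = 0)
    (hadj : ∀ X ∈ 𝔊, ∃ Y ∈ 𝔊, ∀ x y, s (X x) y = s x (Y y))
    {A : Module.End ℂ W} (hA : A ∈ 𝔊) (hΘA : Θ * A = A) (hAΘ : A * Θ = -A)
    (h2 : 2 ≤ Module.finrank ℂ (LinearMap.range A))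
    (hA2 : Module.finrank ℂ (LinearMap.range A) + 2 ≤ Module.finrank ℂ P)
    (hcore : ∀ (U : Submodule ℂ W) (𝔩 : Submodule ℂ (Module.End ℂ U)) (ι : Module.End ℂ U) (P' Q' : Submodule ℂ U),
      (∀ A ∈ 𝔩, ∀ A' ∈ 𝔩, A * A' - A' * A ∈ 𝔩) →
      (∀ V : Submodule ℂ U, (∀ A ∈ 𝔩, ∀ u ∈ V, A u ∈ V) → V = ⊥ ∨ V = ⊤) →
      ι ∈ 𝔩 → ι * ι = 1 → (∀ x, x ∈ P' ↔ ι x = x) → (∀ x, x ∈ Q' ↔ ι x = -x) →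
      Module.finrank ℂ P' + Module.finrank ℂ (LinearMap.range A) = Module.finrank ℂ P →
      Module.finrank ℂ Q' = Module.finrank ℂ (LinearMap.range A) →
      (∀ p ∈ P', ∀ q ∈ Q', s (p : W) q = 0) → (∀ p ∈ P', s (p : W) p = 0 → p = 0) →
      (∀ q ∈ Q', s (q : W) q = 0 → q = 0) →
      (∀ A ∈ 𝔩, ∃ A' ∈ 𝔩, ∀ x y : U, s ((A x : U) : W) y = s x ((A' y : U) : W)) → 𝔩 = ⊤) :
    ∃ B₁ ∈ 𝔊, ∃ B₂ ∈ 𝔊, Θ * B₁ = B₁ ∧ B₁ * Θ = -B₁ ∧ Θ * B₂ = B₂ ∧ B₂ * Θ = -B₂ ∧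
      ∃ m₀ m₁ m₂ m₃ : ℕ, m₀ ≤ Module.finrank ℂ (LinearMap.range A) ∧ m₁ ≤ Module.finrank ℂ (LinearMap.range A) ∧
        m₂ ≤ Module.finrank ℂ (LinearMap.range A) ∧ m₃ ≤ Module.finrank ℂ (LinearMap.range A) ∧
        Module.finrank ℂ (LinearMap.range B₁) = 1 + m₀ ∧
        Module.finrank ℂ (LinearMap.range (B₁ + B₂)) = 2 + m₁ ∧
        Module.finrank ℂ (LinearMap.range (B₁ - B₂)) = 2 + m₂ ∧
        Module.finrank ℂ (LinearMap.range (B₁ + (2 : ℂ) • B₂)) = 2 + m₃ ∧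
        (m₁ ≤ 1 → m₂ ≤ 1 → m₃ ≤ 1 → m₀ ≤ 1) := by
  classical
  obtain ⟨haddr, h0r, h0l, hnegr, hnegl, hsubr, hsubl⟩ := UnitaryTwoOdd.herm_right hadd hsymm
  have hΘΘv : ∀ v, Θ (Θ v) = v := fun v => by rw [← Module.End.mul_apply, hΘΘ, Module.End.one_apply]
  have hPhat : ∀ w, (2 : ℂ)⁻¹ • (w + Θ w) ∈ P := fun w => (hP _).2 (by rw [map_smul, map_add, hΘΘv, add_comm])
  have hsplitΘ : ∀ w, (2 : ℂ)⁻¹ • (w + Θ w) + (2 : ℂ)⁻¹ • (w - Θ w) = w := fun w => by module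
  obtain ⟨C, hC, ι, hιmem, hAC, hΘC, hCΘ, hιι, hιΘ, hιs, hιa, hιd, hιb, hιc, hmemA, hmemD, hmemB, hmemC, hfinP₀, hfinQ₀,
    hfinQU, hrangeP, hmapCQ, hfinUm, hfinUp⟩ :=
    UnitaryLeviKernel.exists_involution hbr hΘ hΘΘ hP hQ hadd hsymm hPQ hdefP hdefQ hadj hA hΘA hAΘ
  have hιv : ∀ v, ι (ι v) = v := fun v => by rw [← Module.End.mul_apply, hιι, Module.End.one_apply]
  have hιΘv : ∀ w, ι (Θ w) = Θ (ι w) := fun w => by rw [← Module.End.mul_apply, hιΘ, Module.End.mul_apply]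
  set ρ := Module.finrank ℂ (LinearMap.range A) with hρdef
  set Um : Submodule ℂ W := LinearMap.ker (ι + 1) with hUmdef
  set Up : Submodule ℂ W := LinearMap.ker (ι - 1) with hUpdef
  have hUm : ∀ x, x ∈ Um ↔ ι x = -x := fun x => by
    rw [hUmdef, LinearMap.mem_ker, LinearMap.add_apply, Module.End.one_apply, add_eq_zero_iff_eq_neg]
  have hUp : ∀ x, x ∈ Up ↔ ι x = x := fun x => by
    rw [hUpdef, LinearMap.mem_ker, LinearMap.sub_apply, Module.End.one_apply, sub_eq_zero]
  have hcm : ∀ Z : Module.End ℂ W, Z * ι = ι * Z → ∀ x ∈ Um, Z x ∈ Um := fun Z hZ x hx =>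
    (hUm _).2 (by rw [← Module.End.mul_apply, ← hZ, Module.End.mul_apply, (hUm x).1 hx, map_neg])
  have hcp : ∀ Z : Module.End ℂ W, Z * ι = ι * Z → ∀ x ∈ Up, Z x ∈ Up := fun Z hZ x hx =>
    (hUp _).2 (by rw [← Module.End.mul_apply, ← hZ, Module.End.mul_apply, (hUp x).1 hx])
  have hUpm : Up ⊓ Um = ⊥ := by
    rw [eq_bot_iff]
    intro x hx
    obtain ⟨h1, h2⟩ := Submodule.mem_inf.1 hx
    rw [Submodule.mem_bot]
    have e1 := (hUp x).1 h1; have e2 := (hUm x).1 h2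
    rw [e1] at e2
    have : (2 : ℂ) • x = 0 := by rw [two_smul]; nth_rewrite 2 [e2]; rw [add_neg_cancel]
    exact (smul_eq_zero.1 this).resolve_left two_ne_zero
  have hUsup : Up ⊔ Um = ⊤ := by
    rw [eq_top_iff]
    intro w _
    have hm : (2 : ℂ)⁻¹ • (w - ι w) ∈ Um := (hUm _).2 (by rw [map_smul, map_sub, hιv, ← smul_neg, neg_sub])
    have hp : (2 : ℂ)⁻¹ • (w + ι w) ∈ Up := (hUp _).2 (by rw [map_smul, map_add, hιv, add_comm])
    have hw : w = (2 : ℂ)⁻¹ • (w + ι w) + (2 : ℂ)⁻¹ • (w - ι w) := by module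
    rw [hw]
    exact Submodule.add_mem _ (Submodule.mem_sup_left hp) (Submodule.mem_sup_right hm)
  -- STEP 1: the Levi algebra on `U⁺ = (P ∩ ker C) ⊕ C(P)` (type `(a − ρ | ρ)`) is full
  have hnι : -ι ∈ 𝔊 := Submodule.neg_mem _ hιmem
  have hnιι : (-ι) * (-ι) = 1 := by rw [neg_mul_neg, hιι]
  have hnιs : ∀ x y, s ((-ι) x) y = s x ((-ι) y) := fun x y => by
    rw [LinearMap.neg_apply, LinearMap.neg_apply, hnegl, hnegr, hιs]
  have hnιΘ : (-ι) * Θ = Θ * (-ι) := by rw [neg_mul, mul_neg, hιΘ]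
  have hUp' : ∀ x, x ∈ Up ↔ (-ι) x = -x := fun x => by rw [hUp, LinearMap.neg_apply, neg_inj]
  have hPUle' : P ⊓ LinearMap.ker C ≤ Up := fun x hx => (hUp x).2 (hιb x hx)
  have hQUle' : P.map C ≤ Up := fun x hx => (hUp x).2 (hιc x hx)
  have hPUmem' : ∀ x ∈ Up, Θ x = x → x ∈ P ⊓ LinearMap.ker C := fun x hx hΘx => hmemB x ((hUp x).1 hx) hΘx
  have hPUΘ' : ∀ x ∈ P ⊓ LinearMap.ker C, Θ x = x := fun x hx => (hP x).1 (Submodule.mem_inf.1 hx).1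
  have hQUmem' : ∀ x ∈ Up, Θ x = -x → x ∈ P.map C := fun x hx hΘx => hmemC x ((hUp x).1 hx) hΘx
  have hQUΘ' : ∀ x ∈ P.map C, Θ x = -x := fun x hx => (hQ x).1 (hmapCQ hx)
  have hPUQU' : ∀ x ∈ P ⊓ LinearMap.ker C, ∀ y ∈ P.map C, s x y = 0 := fun x hx y hy =>
    hPQ x (Submodule.mem_inf.1 hx).1 y (hmapCQ hy)
  have hdefPU' : ∀ x ∈ P ⊓ LinearMap.ker C, s x x = 0 → x = 0 := fun x hx h =>
    hdefP x (Submodule.mem_inf.1 hx).1 h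
  have hdefQU' : ∀ y ∈ P.map C, s y y = 0 → y = 0 := fun y hy h => hdefQ y (hmapCQ hy) h
  have hfullp' := UnitaryThreeCoprime.levi_instance hbr hirr hΘΘ hP hQ hadd hsymm hPQ hdefP hdefQ hadj hnι hnιι hnιs hΘ
    hΘΘ hnιΘ hUp' hPUle' hQUle' hPUmem' hPUΘ' hQUmem' hQUΘ' hPUQU' hdefPU' hdefQU'
    (fun 𝔩 ι' P' Q' hbr𝔩 hirr𝔩 hι' hι'ι' hP' hQ' hfinP' hfinQ' hP'Q' hdefP' hdefQ' hadj𝔩 =>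
      hcore Up 𝔩 ι' P' Q' hbr𝔩 hirr𝔩 hι' hι'ι' hP' hQ' (by rw [hfinP', add_comm]; exact hfinP₀)
        (by rw [hfinQ', hfinQU]) hP'Q' hdefP' hdefQ' hadj𝔩)
  have hfullp : ∀ T : Module.End ℂ Up, ∃ Z ∈ 𝔊, Z * ι = ι * Z ∧ ∀ x : Up, ((T x : Up) : W) = Z x := fun T => by
    obtain ⟨Z, hZ, hZc, hT⟩ := hfullp' T
    exact ⟨Z, hZ, by rw [mul_neg, neg_mul, neg_inj] at hZc; exact hZc, hT⟩
  -- STEP 2: two independent vectors `e₁, e₂ ∈ P ∩ ker C`, two in `C(P)` with a dual pair, the functionals `ψᵢ`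
  have hfinB : 2 ≤ Module.finrank ℂ ↥(P ⊓ LinearMap.ker C) := by omega
  obtain ⟨e₁, he₁, e₂, he₂m, he₁0, he₂⟩ := UnitaryPencil.exists_pair_of_two_le_finrank (P ⊓ LinearMap.ker C) hfinB
  have hfinG : 2 ≤ Module.finrank ℂ ↥(P.map C) := by rw [hfinQU]; exact h2
  obtain ⟨g₁, hg₁, g₂, hg₂, hg₁0, hg₂'⟩ := UnitaryPencil.exists_pair_of_two_le_finrank (P.map C) hfinG
  obtain ⟨χ₁, χ₂, hχ₁₁, hχ₁₂, hχ₂₁, hχ₂₂⟩ := UnitaryPencil.exists_dual_pair hg₁0 hg₂'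
  have hΘe₁ : Θ e₁ = e₁ := hPUΘ' e₁ he₁
  have hΘe₂ : Θ e₂ = e₂ := hPUΘ' e₂ he₂m
  have hΘg₁ : Θ g₁ = -g₁ := hQUΘ' g₁ hg₁
  have hΘg₂ : Θ g₂ = -g₂ := hQUΘ' g₂ hg₂
  have he₁U : e₁ ∈ Up := hPUle' he₁
  have he₂U : e₂ ∈ Up := hPUle' he₂m
  have hg₁U : g₁ ∈ Up := hQUle' hg₁
  have hg₂U : g₂ ∈ Up := hQUle' hg₂
  set πQ : Module.End ℂ W := (2 : ℂ)⁻¹ • (1 - Θ) with hπQdef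
  have hπQapply : ∀ x, πQ x = (2 : ℂ)⁻¹ • (x - Θ x) := fun x => by
    rw [hπQdef, LinearMap.smul_apply, LinearMap.sub_apply, Module.End.one_apply]
  have hπQ_Q : ∀ x, Θ x = -x → πQ x = x := fun x hx => by rw [hπQapply, hx]; module
  have hπQ_P : ∀ x, Θ x = x → πQ x = 0 := fun x hx => by rw [hπQapply, hx, sub_self, smul_zero]
  have hπQ_Θ : ∀ x, πQ (Θ x) = -πQ x := fun x => by rw [hπQapply, hπQapply, hΘΘv]; module
  -- the lifted raising operators
  have hlift : ∀ (χ : Module.Dual ℂ W) (e : W), e ∈ Up → Θ e = e →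
      ∃ B ∈ 𝔊, Θ * B = B ∧ B * Θ = -B ∧ B * ι = ι * B ∧ ∀ x ∈ Up, B x = (χ (πQ x)) • e := by
    intro χ e heU hΘe
    set T : Module.End ℂ Up := ((χ ∘ₗ πQ) ∘ₗ Up.subtype).smulRight ⟨e, heU⟩ with hTdef
    obtain ⟨Z, hZ, hZc, hZT⟩ := hfullp T
    have hZval : ∀ x ∈ Up, Z x = (χ (πQ x)) • e := fun x hx => by
      have h := hZT ⟨x, hx⟩
      rw [hTdef, LinearMap.smulRight_apply, Submodule.coe_smul, LinearMap.comp_apply, LinearMap.comp_apply,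
        Submodule.subtype_apply] at h
      exact h.symm
    set B : Module.End ℂ W := (4 : ℂ)⁻¹ • (Z + Θ * Z - Z * Θ - Θ * Z * Θ) with hBdef
    have hBmem : B ∈ 𝔊 := UnitaryTheta.raise_mem hbr hΘ hΘΘv hZ
    have hΘB : Θ * B = B := LinearMap.ext fun v => UnitaryTheta.apply_raise_apply hΘΘv Z v
    have hBP : ∀ p, Θ p = p → B p = 0 := fun p hp => UnitaryTheta.raise_apply_of_eq Θ Z hp
    have hBΘ : B * Θ = -B := by
      refine LinearMap.ext fun w => ?_
      rw [Module.End.mul_apply, LinearMap.neg_apply]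
      have hΘw : Θ w = (2 : ℂ)⁻¹ • (w + Θ w) - (2 : ℂ)⁻¹ • (w - Θ w) := by module
      conv_lhs => rw [hΘw, map_sub, hBP _ ((hP _).1 (hPhat w)), zero_sub]
      conv_rhs => rw [← hsplitΘ w, map_add, hBP _ ((hP _).1 (hPhat w)), zero_add]
    have hBc : B * ι = ι * B := UnitaryLeviKernel.raise_commute hιΘ hZc
    refine ⟨B, hBmem, hΘB, hBΘ, hBc, fun x hx => ?_⟩
    have hq : (2 : ℂ)⁻¹ • (x - Θ x) ∈ Up :=
      Submodule.smul_mem _ _ (Submodule.sub_mem _ hx (hcp Θ hιΘ.symm x hx))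
    have hππ : πQ (πQ x) = πQ x := by
      rw [hπQapply (πQ x), hπQapply, map_smul, map_sub, hΘΘv]; module
    have hZq : Z ((2 : ℂ)⁻¹ • (x - Θ x)) = (χ (πQ x)) • e := by rw [hZval _ hq, ← hπQapply x, hππ]
    rw [hBdef, UnitaryTheta.raise_apply, hZq, map_smul Θ (χ (πQ x)) e, hΘe]
    module
  obtain ⟨B₁, hB₁, hΘB₁, hB₁Θ, hB₁c, hB₁val⟩ := hlift χ₁ e₁ he₁U hΘe₁
  obtain ⟨B₂, hB₂, hΘB₂, hB₂Θ, hB₂c, hB₂val⟩ := hlift χ₂ e₂ he₂U hΘe₂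
  -- STEP 3: the pencil `X c = B₁ + c B₂`
  have hX : ∀ c : ℂ,
      Module.finrank ℂ (LinearMap.range (B₁ + c • B₂)) =
        (if c = 0 then 1 else 2) + Module.finrank ℂ ↥(Um.map (B₁ + c • B₂)) ∧
      Module.finrank ℂ ↥(Um.map (B₁ + c • B₂)) ≤ ρ := by
    intro c
    set X : Module.End ℂ W := B₁ + c • B₂ with hXdef
    have hΘX : Θ * X = X := by rw [hXdef, mul_add, mul_smul_comm, hΘB₁, hΘB₂]
    have hXc : X * ι = ι * X := by rw [hXdef, add_mul, mul_add, smul_mul_assoc, mul_smul_comm, hB₁c, hB₂c]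
    have hXval : ∀ x ∈ Up, X x = (χ₁ (πQ x)) • e₁ + (c * χ₂ (πQ x)) • e₂ := fun x hx => by
      rw [hXdef, LinearMap.add_apply, LinearMap.smul_apply, hB₁val x hx, hB₂val x hx, smul_smul]
    have hXg₁ : X g₁ = e₁ := by
      rw [hXval g₁ hg₁U, hπQ_Q g₁ hΘg₁, hχ₁₁, hχ₂₁, one_smul, mul_zero, zero_smul, add_zero]
    have hXg₂ : X g₂ = c • e₂ := by
      rw [hXval g₂ hg₂U, hπQ_Q g₂ hΘg₂, hχ₁₂, hχ₂₂, zero_smul, mul_one, zero_add]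
    -- `X(U⁺) = ℂe₁ + ℂ(c e₂)`
    have hmapUp : Up.map X = (ℂ ∙ e₁) ⊔ (ℂ ∙ (c • e₂)) := by
      apply le_antisymm
      · rintro _ ⟨x, hx, rfl⟩
        rw [hXval x hx]
        refine Submodule.add_mem _ (Submodule.mem_sup_left (Submodule.smul_mem _ _ (Submodule.mem_span_singleton_self _)))
          (Submodule.mem_sup_right ?_)
        rw [mul_comm, mul_smul]
        exact Submodule.smul_mem _ _ (Submodule.mem_span_singleton_self _)
      · refine sup_le ?_ ?_
        · rw [Submodule.span_singleton_le_iff_mem]; exact ⟨g₁, hg₁U, hXg₁⟩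
        · rw [Submodule.span_singleton_le_iff_mem]; exact ⟨g₂, hg₂U, hXg₂⟩
    have hfinUp' : Module.finrank ℂ ↥(Up.map X) = if c = 0 then 1 else 2 := by
      rw [hmapUp]
      by_cases hc : c = 0
      · rw [if_pos hc, hc, zero_smul, Submodule.span_zero_singleton, sup_bot_eq, finrank_span_singleton he₁0]
      · rw [if_neg hc]
        have he₂0 : c • e₂ ≠ 0 := fun h => he₂ (by
          rw [smul_eq_zero] at h
          rcases h with h | h
          · exact absurd h hc
          · rw [h]; exact Submodule.zero_mem _)
        have hinf : (ℂ ∙ e₁) ⊓ (ℂ ∙ (c • e₂)) = ⊥ := by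
          rw [eq_bot_iff]
          intro y hy
          obtain ⟨hy1, hy2⟩ := Submodule.mem_inf.1 hy
          rw [Submodule.mem_bot]
          obtain ⟨d, rfl⟩ := Submodule.mem_span_singleton.1 hy2
          by_cases hd : d = 0
          · rw [hd, zero_smul]
          · exfalso
            apply he₂
            have : e₂ = (d * c)⁻¹ • (d • c • e₂) := by
              rw [smul_smul, smul_smul, mul_assoc, inv_mul_cancel₀ (mul_ne_zero hd hc), one_smul]
            rw [this]
            exact Submodule.smul_mem _ _ hy1
        have h := Submodule.finrank_sup_add_finrank_inf_eq (ℂ ∙ e₁) (ℂ ∙ (c • e₂))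
        rw [hinf, finrank_bot, add_zero, finrank_span_singleton he₁0, finrank_span_singleton he₂0] at h
        exact h
    -- `X(U⁻) ⊆ A(W)`
    have hmapUm : Um.map X ≤ LinearMap.range A := by
      rintro _ ⟨m, hm, rfl⟩
      refine hmemA _ ((hUm _).1 (hcm X hXc m hm)) ?_
      rw [← Module.End.mul_apply, hΘX]
    -- `rk X = dim X(U⁺) + dim X(U⁻)`
    have hrange : LinearMap.range X = Up.map X ⊔ Um.map X := by
      rw [LinearMap.range_eq_map, ← hUsup, Submodule.map_sup]
    have hinf : Up.map X ⊓ Um.map X = ⊥ := by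
      rw [eq_bot_iff, ← hUpm]
      rintro y ⟨⟨x, hx, rfl⟩, hy2⟩
      obtain ⟨m, hm, hmx⟩ := hy2
      exact Submodule.mem_inf.2 ⟨hcp X hXc x hx, by rw [← hmx]; exact hcm X hXc m hm⟩
    have h := Submodule.finrank_sup_add_finrank_inf_eq (Up.map X) (Um.map X)
    rw [← hrange, hinf, finrank_bot, add_zero, hfinUp'] at h
    exact ⟨h, Submodule.finrank_mono hmapUm⟩
  -- STEP 4: the four members of the pencil and the three-point lemma
  obtain ⟨hX0, hm0⟩ := hX 0
  obtain ⟨hX1, hm1⟩ := hX 1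
  obtain ⟨hX2, hm2⟩ := hX (-1)
  obtain ⟨hX3, hm3⟩ := hX 2
  rw [if_pos rfl, zero_smul, add_zero] at hX0
  rw [zero_smul, add_zero] at hm0
  rw [if_neg one_ne_zero, one_smul] at hX1
  rw [one_smul] at hm1
  rw [if_neg (by norm_num), neg_one_smul, ← sub_eq_add_neg] at hX2
  rw [neg_one_smul, ← sub_eq_add_neg] at hm2
  rw [if_neg (by norm_num)] at hX3
  refine ⟨B₁, hB₁, B₂, hB₂, hΘB₁, hB₁Θ, hΘB₂, hB₂Θ, _, _, _, _, hm0, hm1, hm2, hm3, hX0, hX1, hX2, hX3,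
    fun h1 h2' h3 => ?_⟩
  obtain ⟨p₁, hp₁⟩ := UnitaryPencil.exists_line_of_finrank_map_le_one (B₁ + B₂) Um h1
  obtain ⟨p₂, hp₂⟩ := UnitaryPencil.exists_line_of_finrank_map_le_one (B₁ - B₂) Um h2'
  obtain ⟨p₃, hp₃⟩ := UnitaryPencil.exists_line_of_finrank_map_le_one (B₁ + (2 : ℂ) • B₂) Um h3
  obtain ⟨p, hp⟩ := UnitaryPencil.exists_line_of_three (B₁.domRestrict Um) (B₂.domRestrict Um) (p₁ := p₁) (p₂ := p₂)
    (p₃ := p₃) (fun x => by simpa using hp₁ x x.2) (fun x => by simpa using hp₂ x x.2)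
    (fun x => by simpa using hp₃ x x.2)
  have hle : Um.map B₁ ≤ ℂ ∙ p := by
    rintro _ ⟨m, hm, rfl⟩
    have := hp ⟨m, hm⟩
    rwa [LinearMap.domRestrict_apply] at this
  exact (Submodule.finrank_mono hle).trans ((finrank_span_le_card _).trans (by simp))

end HodgeStructure

end Literature.AlgebraicGeometry.Motives
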